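import Summits.HodgeConjecture.HodgeConjecture.Theorems.K2E1bU21WeightSpaces
import Literature.NumberTheory.Automorphic.U21RootMonomials
import HarnessLib

/-!
# K2 ∕ E1b — αᵤ road FILE 1 (sequel) «the root operators on weight spaces; the `𝔨`-HIGHEST LINES `hwSpace`; the labels `(n, m, e)`»

Cell hodgecm-mathlib, Track B «K2-LIT», engine E1b, unit U8; crux item h413 = stmt-HodgeConjecture-24833 (supports-only helper; closes nothing).  Split off
★ `Theorems/K2E1bU21WeightSpaces.lean` for the 400-line lint (K2E1b-plan (g4) ruling 03:56:06Z: «the `hwSpace` def + label dictionary live in YOUR file … if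
file 1 passes 400 l., split §3 off as `Theorems/K2E1bU21HighestWeightSpaces.lean`»).  Author K2-defs1 (g3).  DEFINITIONS WITH BODIES (`hwSpace`, `labelN`,
`labelM`, `labelE`) + theorems; no `sorry`, no axiom, no instance (one `attribute [local instance] LieRing.ofAssociativeRing`), no notation.

## What is proved

* the ★ `U21RootMonomials` operators in weight-space currency: `u21e∕u21f∕u21h∕u21E j∕u21F j = ρ_ℂ(E_ab)` for the corresponding matrix units of
  `Fin 2 ⊕ Fin 1` (`u21e_eq`, …, over the block identities `fromBlocks_single_zero`, …); `h` acts on `V[w]` by `w₀ − w₁` (`u21h_apply_of_mem_wtSpace`)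
  `= n − 1` (`u21h_apply_of_mem_wtSpace'`); the shifts `e V[w] ⊆ V[w + δ₀ − δ₁]`, `f V[w] ⊆ V[w + δ₁ − δ₀]`, `E_j V[w] ⊆ V[w + δ_{inl j} − δ_{inr 0}]`,
  `F_j V[w] ⊆ V[w + δ_{inr 0} − δ_{inl j}]` (Kovačević's arrows: `𝔭^±` move `m` by `±3`, `n` by `±1`);
* **`hwSpace ρ𝔤 w := wtSpace ρ𝔤 w ⊓ ker (u21e ρ𝔤)`** — the highest-weight vectors `u¹_{n,m}` of the `K`-types of highest torus weight `w` (`mem_hwSpace_iff`);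
* the LABELS `labelN w = w₀ − w₁ + 1` (= `n`, the dimension of the `K`-type), `labelM w = w₀ + w₁ − 2w₂` (= `m`, the `Z = H_α + 2H_β`-eigenvalue),
  `labelE w = w₀ + w₁ + w₂` (= `e`, the central weight); `eq_of_labels_eq` (the labels determine `w`); the twist integrality
  `labelM w − 3·labelN w + 3 + 2·labelE w = 6 w₁` (`labelM_sub_labelN_add_labelE` — the hypothesis of ★ `isGKModule_kTypeRepTw` holds automatically); and
  **`labelE_eq_of_center`**: under the centre clause of ★ `HasChiScalars` (`i·1 ↦ e·i`) every non-zero weight space has `labelE w = e`.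

Sources: [Kovacevic2021] §3 Def 1, Thm 1 (labels `(n, m)`, the arrows); [KnappVogan1995] §IV.1; [BorelWallach2000] II §4.1; [Rogawski1990] §12.3 p. 177
(central character).  HONEST LABEL: HC_CM is proved only modulo the 7 printed citations (2 remaining named inputs: hLiu418 = stmt-HodgeConjecture-24832,
h413 = stmt-HodgeConjecture-24833) until rung 0 closes; this file is currency for the αᵤ road and closes nothing.
-/

set_option autoImplicit false
set_option linter.dupNamespace false

noncomputable section

open scoped Matrix ComplexConjugate

namespace Summit.HodgeConjecture.HodgeConjecture.Cruxes.H413.K2E1bU21Weights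

open Literature.NumberTheory.Automorphic
open Literature.RepresentationTheory
open Literature.RepresentationTheory.BorelWallach2000
open Literature.RepresentationTheory.KonnoKonno2007 Literature.RepresentationTheory.KonnoKonno2007.RealDualPair
open Literature.RepresentationTheory.KonnoKonno2007.RealDualPair.UForm
open Summit.HodgeConjecture.HodgeConjecture.Cruxes.H413.F0P3bLocalAPacketsDefs
open Summit.HodgeConjecture.HodgeConjecture.Cruxes.H413.K2E1bGKCohomologyU21 (lieHom_single_apply_comm)

-- Mathlib idiom (as in `GKModules`, the `Upq*` files): commutator bracket on `Module.End` ∕ matrices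
attribute [local instance 100] LieRing.ofAssociativeRing

section Module

variable {V : Type*} [AddCommGroup V] [Module ℂ V]
  {ρK : Representation ℂ G21.maximalCompact V} (ρ𝔤 : G21.lie →ₗ⁅ℝ⁆ Module.End ℂ V)

/-! ## §3 The root operators of ★ `U21RootMonomials` on weight spaces; the `𝔨`-highest lines `hwSpace` and the labels `(n, m, e)` -/

/-- Block embedding of the `𝔨`-units: `[[E_ab, 0], [0, 0]] = E_{inl a, inl b}`. [folklore] -/
theorem fromBlocks_single_zero (a b : Fin 2) :
    Matrix.fromBlocks (Matrix.single a b (1 : ℂ)) 0 0 (0 : Matrix (Fin 1) (Fin 1) ℂ) = Matrix.single (Sum.inl a) (Sum.inl b) 1 := by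
  ext (i | i) (k | k) <;> simp [Matrix.fromBlocks, Matrix.single_apply]

/-- Block embedding of the `𝔭⁺`-units: `[[0, E_{j0}], [0, 0]] = E_{inl j, inr 0}`. [folklore] -/
theorem fromBlocks_zero_single_upper (j : Fin 2) :
    (Matrix.fromBlocks (0 : Matrix (Fin 2) (Fin 2) ℂ) (Matrix.single j (0 : Fin 1) (1 : ℂ)) 0 (0 : Matrix (Fin 1) (Fin 1) ℂ) :
        Matrix (Fin 2 ⊕ Fin 1) (Fin 2 ⊕ Fin 1) ℂ) = Matrix.single (Sum.inl j) (Sum.inr (0 : Fin 1)) (1 : ℂ) := by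
  ext (i | i) (k | k) <;> simp [Matrix.fromBlocks, Matrix.single_apply]

/-- Block embedding of the `𝔭⁻`-units: `[[0, 0], [E_{0j}, 0]] = E_{inr 0, inl j}`. [folklore] -/
theorem fromBlocks_zero_single_lower (j : Fin 2) :
    (Matrix.fromBlocks (0 : Matrix (Fin 2) (Fin 2) ℂ) 0 (Matrix.single (0 : Fin 1) j (1 : ℂ)) (0 : Matrix (Fin 1) (Fin 1) ℂ) :
        Matrix (Fin 2 ⊕ Fin 1) (Fin 2 ⊕ Fin 1) ℂ) = Matrix.single (Sum.inr (0 : Fin 1)) (Sum.inl j) (1 : ℂ) := by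
  ext (i | i) (k | k) <;> simp [Matrix.fromBlocks, Matrix.single_apply]

/-- Block embedding of the Cartan element: `[[E₀₀ − E₁₁, 0], [0, 0]] = E_{inl 0,inl 0} − E_{inl 1,inl 1}`. [folklore] -/
theorem fromBlocks_single_sub_single_zero :
    (Matrix.fromBlocks (Matrix.single 0 0 (1 : ℂ) - Matrix.single 1 1 (1 : ℂ)) 0 0 (0 : Matrix (Fin 1) (Fin 1) ℂ) :
        Matrix (Fin 2 ⊕ Fin 1) (Fin 2 ⊕ Fin 1) ℂ) =
      Matrix.single (Sum.inl 0) (Sum.inl 0) 1 - Matrix.single (Sum.inl 1) (Sum.inl 1) 1 := by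
  ext (i | i) (k | k) <;> simp [Matrix.fromBlocks, Matrix.single_apply]

/-- ★ `u21e = ρ_ℂ(E_{inl 0, inl 1})`. [cite: KnappVogan1995, §IV.1] -/
theorem u21e_eq : u21e ρ𝔤 = upqLieC ρ𝔤 (Matrix.single (Sum.inl 0) (Sum.inl 1) 1) := by
  rw [u21e, fromBlocks_single_zero]

/-- ★ `u21f = ρ_ℂ(E_{inl 1, inl 0})`. [cite: KnappVogan1995, §IV.1] -/
theorem u21f_eq : u21f ρ𝔤 = upqLieC ρ𝔤 (Matrix.single (Sum.inl 1) (Sum.inl 0) 1) := by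
  rw [u21f, fromBlocks_single_zero]

/-- ★ `u21h = ρ_ℂ(E_{inl 0,inl 0}) − ρ_ℂ(E_{inl 1,inl 1})`. [cite: KnappVogan1995, §IV.1] -/
theorem u21h_eq : u21h ρ𝔤 = upqLieC ρ𝔤 (Matrix.single (Sum.inl 0) (Sum.inl 0) 1) - upqLieC ρ𝔤 (Matrix.single (Sum.inl 1) (Sum.inl 1) 1) := by
  rw [u21h, fromBlocks_single_sub_single_zero, map_sub]

/-- ★ `u21E j = ρ_ℂ(E_{inl j, inr 0})`. [cite: BorelWallach2000, II §4.1] -/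
theorem u21E_eq (j : Fin 2) : u21E ρ𝔤 j = upqLieC ρ𝔤 (Matrix.single (Sum.inl j) (Sum.inr 0) 1) := by
  rw [u21E_def, upqEOp, LinearMap.comp_apply]
  exact congrArg (upqLieC ρ𝔤) (fromBlocks_zero_single_upper j)

/-- ★ `u21F j = ρ_ℂ(E_{inr 0, inl j})`. [cite: BorelWallach2000, II §4.1] -/
theorem u21F_eq (j : Fin 2) : u21F ρ𝔤 j = upqLieC ρ𝔤 (Matrix.single (Sum.inr 0) (Sum.inl j) 1) := by
  rw [u21F_def, upqFOp, LinearMap.comp_apply]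
  exact congrArg (upqLieC ρ𝔤) (fromBlocks_zero_single_lower j)

/-- **`h` acts on `V[w]` by `w₀ − w₁`.** [cite: KnappVogan1995, §IV.1] -/
theorem u21h_apply_of_mem_wtSpace {w : Fin 2 ⊕ Fin 1 → ℤ} {v : V} (hv : v ∈ wtSpace ρ𝔤 w) :
    u21h ρ𝔤 v = ((w (Sum.inl 0) - w (Sum.inl 1) : ℤ) : ℂ) • v := by
  rw [mem_wtSpace_iff] at hv
  rw [u21h_eq, LinearMap.sub_apply, hv, hv, ← sub_smul, Int.cast_sub]

/-- `e V[w] ⊆ V[w + δ₀ − δ₁]`. [cite: Kovacevic2021, §3 Def 1] -/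
theorem u21e_apply_mem_wtSpace {w : Fin 2 ⊕ Fin 1 → ℤ} {v : V} (hv : v ∈ wtSpace ρ𝔤 w) :
    u21e ρ𝔤 v ∈ wtSpace ρ𝔤 (w + Pi.single (Sum.inl 0) 1 - Pi.single (Sum.inl 1) 1) := by
  rw [u21e_eq]; exact upqLieC_single_apply_mem_wtSpace ρ𝔤 hv _ _

/-- `f V[w] ⊆ V[w + δ₁ − δ₀]`. [cite: Kovacevic2021, §3 Def 1] -/
theorem u21f_apply_mem_wtSpace {w : Fin 2 ⊕ Fin 1 → ℤ} {v : V} (hv : v ∈ wtSpace ρ𝔤 w) :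
    u21f ρ𝔤 v ∈ wtSpace ρ𝔤 (w + Pi.single (Sum.inl 1) 1 - Pi.single (Sum.inl 0) 1) := by
  rw [u21f_eq]; exact upqLieC_single_apply_mem_wtSpace ρ𝔤 hv _ _

/-- `E_j V[w] ⊆ V[w + δ_{inl j} − δ_{inr 0}]` (`𝔭⁺` raises `m` by `3`). [cite: Kovacevic2021, §3 Thm 1] -/
theorem u21E_apply_mem_wtSpace (j : Fin 2) {w : Fin 2 ⊕ Fin 1 → ℤ} {v : V} (hv : v ∈ wtSpace ρ𝔤 w) :
    u21E ρ𝔤 j v ∈ wtSpace ρ𝔤 (w + Pi.single (Sum.inl j) 1 - Pi.single (Sum.inr 0) 1) := by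
  rw [u21E_eq]; exact upqLieC_single_apply_mem_wtSpace ρ𝔤 hv _ _

/-- `F_j V[w] ⊆ V[w + δ_{inr 0} − δ_{inl j}]` (`𝔭⁻` lowers `m` by `3`). [cite: Kovacevic2021, §3 Thm 1] -/
theorem u21F_apply_mem_wtSpace (j : Fin 2) {w : Fin 2 ⊕ Fin 1 → ℤ} {v : V} (hv : v ∈ wtSpace ρ𝔤 w) :
    u21F ρ𝔤 j v ∈ wtSpace ρ𝔤 (w + Pi.single (Sum.inr 0) 1 - Pi.single (Sum.inl j) 1) := by
  rw [u21F_eq]; exact upqLieC_single_apply_mem_wtSpace ρ𝔤 hv _ _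

/-- **The `𝔨`-highest line of weight `w`**: `hwSpace w = V[w] ∩ ker e` — the highest-weight vectors `u¹_{n,m}` of the `K`-types of highest torus weight
`w` (ONE line per `K`-type under multiplicity one; finite-dimensional under admissibility — both proved downstream, not here).
— a route-posited definition of the engine line (hence untagged). -/
def hwSpace (w : Fin 2 ⊕ Fin 1 → ℤ) : Submodule ℂ V :=
  wtSpace ρ𝔤 w ⊓ LinearMap.ker (u21e ρ𝔤)

/-- Membership in `hwSpace`. [cite: Kovacevic2021, §3 Def 1] -/
theorem mem_hwSpace_iff (w : Fin 2 ⊕ Fin 1 → ℤ) (v : V) : v ∈ hwSpace ρ𝔤 w ↔ v ∈ wtSpace ρ𝔤 w ∧ u21e ρ𝔤 v = 0 := by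
  rw [hwSpace, Submodule.mem_inf, LinearMap.mem_ker]

/-- **The `K`-type dimension label `n = w₀ − w₁ + 1`** of a highest weight `w` (`h u¹ = (n−1) u¹`, Kovačević's `n = dim V_{n,m}`).
— a route-posited definition of the engine line (hence untagged). -/
def labelN (w : Fin 2 ⊕ Fin 1 → ℤ) : ℤ := w (Sum.inl 0) - w (Sum.inl 1) + 1

/-- **The `Z`-label `m = w₀ + w₁ − 2w₂`** (`Z = H_α + 2H_β = E₀₀ + E₁₁ − 2E₂₂` acts on `V_{n,m}` by `m`).
— a route-posited definition of the engine line (hence untagged). -/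
def labelM (w : Fin 2 ⊕ Fin 1 → ℤ) : ℤ := w (Sum.inl 0) + w (Sum.inl 1) - 2 * w (Sum.inr 0)

/-- **The central label `e = w₀ + w₁ + w₂`** (the centre `i·1` acts by `i·e`).
— a route-posited definition of the engine line (hence untagged). -/
def labelE (w : Fin 2 ⊕ Fin 1 → ℤ) : ℤ := w (Sum.inl 0) + w (Sum.inl 1) + w (Sum.inr 0)

/-- **The labels determine the weight** (the `3 × 3` system is unimodular up to the integrality below). [cite: Kovacevic2021, §3 Def 1] -/
theorem eq_of_labels_eq {w w' : Fin 2 ⊕ Fin 1 → ℤ} (hN : labelN w = labelN w') (hM : labelM w = labelM w') (hE : labelE w = labelE w') : w = w' := by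
  unfold labelN at hN; unfold labelM at hM; unfold labelE at hE
  funext j
  rcases j with j | j
  · fin_cases j
    · show w (Sum.inl 0) = w' (Sum.inl 0); omega
    · show w (Sum.inl 1) = w' (Sum.inl 1); omega
  · fin_cases j
    show w (Sum.inr 0) = w' (Sum.inr 0); omega

/-- **The integrality identity of the twist**: `m − 3n + 3 + 2e = 6·w₁` (so `6 ∣ m − 3n + 3 + 2e` automatically — r01 (g4) N3; ★ `isGKModule_kTypeRepTw`'s
hypothesis at the record). [cite: Kovacevic2021, §3 Def 1] -/
theorem labelM_sub_labelN_add_labelE (w : Fin 2 ⊕ Fin 1 → ℤ) : labelM w - 3 * labelN w + 3 + 2 * labelE w = 6 * w (Sum.inl 1) := by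
  unfold labelM labelN labelE; ring

/-- **`h` acts on `V[w]` by `n − 1`.** [cite: Kovacevic2021, §3 Def 1] -/
theorem u21h_apply_of_mem_wtSpace' {w : Fin 2 ⊕ Fin 1 → ℤ} {v : V} (hv : v ∈ wtSpace ρ𝔤 w) :
    u21h ρ𝔤 v = ((labelN w - 1 : ℤ) : ℂ) • v := by
  rw [u21h_apply_of_mem_wtSpace ρ𝔤 hv, labelN, add_sub_cancel_right]

/-- **The central label under χ-scalars**: if every `Z ∈ 𝔲(2,1)` with matrix `i·1` acts by `e·i` (the second clause of ★ `HasChiScalars`) and `V[w] ≠ 0`,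
then `labelE w = e`. [cite: Rogawski1990, §12.3 p. 177] -/
theorem labelE_eq_of_center {w : Fin 2 ⊕ Fin 1 → ℤ} {v : V} (hv : v ∈ wtSpace ρ𝔤 w) (hv0 : v ≠ 0) {e : ℤ}
    (hZ : ∀ Z : G21.lie, (Z : Matrix (Fin 2 ⊕ Fin 1) (Fin 2 ⊕ Fin 1) ℂ) = Complex.I • (1 : Matrix (Fin 2 ⊕ Fin 1) (Fin 2 ⊕ Fin 1) ℂ) →
      ∀ v : V, ρ𝔤 Z v = ((e : ℂ) * Complex.I) • v) :
    labelE w = e := by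
  -- `Z = t₀ + t₁ + t₂` has matrix `i·1` and acts on `v` by `i·(w₀+w₁+w₂)`
  set Z : G21.lie := LieSubalgebra.inclusion G21.compactLie_le_lie (tUnit (Sum.inl 0))
    + LieSubalgebra.inclusion G21.compactLie_le_lie (tUnit (Sum.inl 1)) + LieSubalgebra.inclusion G21.compactLie_le_lie (tUnit (Sum.inr 0)) with hZdef
  have hZmat : (Z : Matrix (Fin 2 ⊕ Fin 1) (Fin 2 ⊕ Fin 1) ℂ) = Complex.I • (1 : Matrix (Fin 2 ⊕ Fin 1) (Fin 2 ⊕ Fin 1) ℂ) := by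
    have hc : (Z : Matrix (Fin 2 ⊕ Fin 1) (Fin 2 ⊕ Fin 1) ℂ) =
        ((LieSubalgebra.inclusion G21.compactLie_le_lie (tUnit (Sum.inl 0)) : G21.lie) : Matrix (Fin 2 ⊕ Fin 1) (Fin 2 ⊕ Fin 1) ℂ)
        + ((LieSubalgebra.inclusion G21.compactLie_le_lie (tUnit (Sum.inl 1)) : G21.lie) : Matrix (Fin 2 ⊕ Fin 1) (Fin 2 ⊕ Fin 1) ℂ)
        + ((LieSubalgebra.inclusion G21.compactLie_le_lie (tUnit (Sum.inr 0)) : G21.lie) : Matrix (Fin 2 ⊕ Fin 1) (Fin 2 ⊕ Fin 1) ℂ) := rfl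
    rw [hc, coe_inclusion_tUnit, coe_inclusion_tUnit, coe_inclusion_tUnit, ← smul_add, ← smul_add]
    congr 1
    ext i k
    rcases i with i | i <;> rcases k with k | k <;> fin_cases i <;> fin_cases k <;> simp
  have h1 := hZ Z hZmat v
  have hw := (mem_wtSpace_iff ρ𝔤 w v).1 hv
  rw [hZdef, map_add, map_add, LinearMap.add_apply, LinearMap.add_apply,
    apply_tUnit_of_upqLieC_single_apply ρ𝔤 (hw _), apply_tUnit_of_upqLieC_single_apply ρ𝔤 (hw _),
    apply_tUnit_of_upqLieC_single_apply ρ𝔤 (hw _), ← add_smul, ← add_smul] at h1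
  have h2 := sub_eq_zero.2 h1
  rw [← sub_smul, smul_eq_zero] at h2
  rcases h2 with h2 | h2
  · have h3 : ((labelE w : ℤ) : ℂ) * Complex.I = (e : ℂ) * Complex.I := by
      rw [labelE]; push_cast; linear_combination h2
    exact_mod_cast mul_right_cancel₀ Complex.I_ne_zero h3
  · exact absurd h2 hv0

end Module

end Summit.HodgeConjecture.HodgeConjecture.Cruxes.H413.K2E1bU21Weights

end
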